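import Mathlib
import Summits.NavierStokesRegularity.FluidComputer.TransportGalerkinAbcSolution
import HarnessLib

/-!
# Galerkin limit of the transport model, XX: the forced-ABC KEEP word as an AMPLITUDE statement — every small perturbation along the certified eigenvector reaches `H²`-size `a` at time `log(2a/ε)/μ` (instab g20, cell `ns-blowup`, 2026-08-27)

HONEST FRAMING (human ruling D-0035): nothing here is a claim about Navier–Stokes blow-up.
WHAT THIS IS NOT: not NS — a MODEL theorem schema about the forced-ABC perturbation equation on
`𝕋³`; its load-bearing inputs are the Lyapunov certificates of record (interval stage not
commissioned) and the certified X0 eigenvalue; no number or census word moves. It is an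
`H²`-amplitude statement (the scaled phase space `E`), NOT a kinetic-energy (`L²`) instability in the
sense of the tree's `Torus.IsLyapunovUnstableSteadyState` (Friedlander–Pavlović–Shvydkoy 2006).

PURPOSE. `TransportGalerkinAbcSolution.exists_keep_solution_abc_final` (g20, part XVIII) reads the
KEEP word on a window `[0, T]` chosen by the user subject to the window condition
`C'(3/2)² ε e^{μt} < 1/2` and gives the floor `ε e^{μt}/2 ≤ ‖w t‖` while `ε e^{μt} ≤ 2/(9C')`. THIS
FILE removes the window bookkeeping: with a STRICTLY positive certified eigenvalue `μ > 0`, for every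
target amplitude `0 < a < 1/(9C')` and every perturbation size `0 < ε ≤ 2a`, on the EXPLICIT window
`T(ε, a) = log(2a/ε)/μ` the window condition holds automatically, so THE solution from `ε•v` exists on
`[0, T(ε, a)]` (smooth-in-space class, unique in the class), grows as `ε e^{μt}/2 ≤ ‖w t‖` throughout,
and satisfies `a ≤ ‖w (T(ε, a))‖` (`exists_keep_amplitude_abc_final`). In words: modulo the
certificates, the forced ABC flow is nonlinearly unstable in `H²` with the ε-INDEPENDENT threshold
`a` (any `a < 1/(9C')`, `C'` the certificate's Duhamel margin) reached from amplitude `ε` in time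
`log(2a/ε)/μ`. Mathlib + the tree file cited; no new definitions.
-/

noncomputable section

open scoped ENNReal NNReal ComplexConjugate InnerProductSpace
open Set Filter Topology

namespace Summit.NavierStokesRegularity.FluidComputer.TransportGalerkinAbcAmplitude

open RCLike MeasureTheory UnitAddTorus
open Literature.Analysis.FunctionSpaces Literature.Analysis.FunctionSpaces.Lattice
open Literature.Analysis.FunctionSpaces.Torus Literature.Analysis.FunctionSpaces.EuclideanSpace
open Literature.Analysis.ODE Literature.Analysis.FluidPDE
open Summit.NavierStokesRegularity.FluidComputer.TransportGalerkin
open Summit.NavierStokesRegularity.FluidComputer.TransportGalerkinAbc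
open Summit.NavierStokesRegularity.FluidComputer.TransportGalerkinAbcSolution

/-- The window arithmetic: for `μ > 0`, `0 < ε ≤ 2a`, the time `T = log(2a/ε)/μ` is `≥ 0` and
`ε e^{μT} = 2a`; on `[0, T]`, `ε e^{μt} ≤ 2a`. -/
theorem window_arith {μ ε a : ℝ} (hμ : 0 < μ) (hε : 0 < ε) (ha : 0 < a) (hεa : ε ≤ 2 * a) :
    0 ≤ Real.log (2 * a / ε) / μ ∧ ε * Real.exp (μ * (Real.log (2 * a / ε) / μ)) = 2 * a ∧
      ∀ t ∈ Icc 0 (Real.log (2 * a / ε) / μ), ε * Real.exp (μ * t) ≤ 2 * a := by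
  have h1 : 1 ≤ 2 * a / ε := by rw [le_div_iff₀ hε]; linarith
  have hlog : 0 ≤ Real.log (2 * a / ε) := Real.log_nonneg h1
  have hT : 0 ≤ Real.log (2 * a / ε) / μ := div_nonneg hlog hμ.le
  have hexpT : ε * Real.exp (μ * (Real.log (2 * a / ε) / μ)) = 2 * a := by
    rw [mul_div_cancel₀ _ hμ.ne', Real.exp_log (by positivity)]
    field_simp
  refine ⟨hT, hexpT, fun t ht => ?_⟩
  calc ε * Real.exp (μ * t) ≤ ε * Real.exp (μ * (Real.log (2 * a / ε) / μ)) := by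
        gcongr
        exact ht.2
    _ = 2 * a := hexpT

/-- **The forced-ABC KEEP word as an amplitude statement** (`exists_keep_amplitude_abc_final`): from
the X0 row `Torus.IsLinNSEigenvalue ν (abcFlow A B C) μ` with `μ > 0`, `ν > 0`, there is the door's
eigenvector `v`, and for EVERY certificate (objects/inequalities at levels `≥ K`, g18's list verbatim),
gap `ω < 2μ`, margin `C'`, EVERY target amplitude `0 < a < 1/(9C')` and EVERY `0 < ε ≤ 2a`: on the window
`[0, log(2a/ε)/μ]` THE classical solution `w` of the model from `ε•v` exists (order-6 tail class, the
three clauses, unique in the class), obeys `ε e^{μt}/2 ≤ ‖w t‖` for all `t` in the window, and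
`a ≤ ‖w (log(2a/ε)/μ)‖`. -/
theorem exists_keep_amplitude_abc_final (K : ℕ) (A B C : ℝ) {ν μ : ℝ} (hν : 0 < ν) (hμ : 0 < μ)
    (heig : Torus.IsLinNSEigenvalue ν (Torus.abcFlow A B C) (μ : ℂ)) :
    ∃ v : lp (fun _ : (Fin 3 → ℤ) => EuclideanSpace ℂ (Fin 3)) 2,
      ‖v‖ = 1 ∧ RapidDecay (⇑v) ∧ (∀ k, lerayCLM k (v k) = v k) ∧
      (∀ (j : Fin 3) (k : Fin 3 → ℤ), (EuclideanSpace.proj j : EuclideanSpace ℂ (Fin 3) →L[ℂ] ℂ) (v (-k)) =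
        conj ((EuclideanSpace.proj j : EuclideanSpace ℂ (Fin 3) →L[ℂ] ℂ) (v k))) ∧
      (∀ k : Fin 3 → ℤ, ∑ j, ((k j : ℤ) : ℂ) * (EuclideanSpace.proj j : EuclideanSpace ℂ (Fin 3) →L[ℂ] ℂ) (v k) = 0) ∧
      linOp ν (mFourierCoeff (complexify ∘ Torus.abcFlow A B C))
          (fun j => (EuclideanSpace.proj j : EuclideanSpace ℂ (Fin 3) →L[ℂ] ℂ)) lerayCLM v = μ • v ∧
      ∀ {μt : ℝ}
        {G₁ G₂ G : lp (fun _ : (Fin 3 → ℤ) => EuclideanSpace ℂ (Fin 3)) 2 →L[ℝ]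
          lp (fun _ : (Fin 3 → ℤ) => EuclideanSpace ℂ (Fin 3)) 2}
        (hG₁ : ∀ x y : lp (fun _ : (Fin 3 → ℤ) => EuclideanSpace ℂ (Fin 3)) 2, ⟪G₁ x, y⟫_ℂ = ⟪x, G₁ y⟫_ℂ)
        (hG₂ : ∀ x y : lp (fun _ : (Fin 3 → ℤ) => EuclideanSpace ℂ (Fin 3)) 2, ⟪G₂ x, y⟫_ℂ = ⟪x, G₂ y⟫_ℂ)
        (hG : ∀ x y : lp (fun _ : (Fin 3 → ℤ) => EuclideanSpace ℂ (Fin 3)) 2, ⟪G x, y⟫_ℂ = ⟪x, G y⟫_ℂ)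
        (hG₁P : ∀ n, ∀ w z : lp (fun _ : (Fin 3 → ℤ) => EuclideanSpace ℂ (Fin 3)) 2,
          ⟪G₁ w, cubeProj (n + K) z⟫_ℂ = ⟪G₁ (cubeProj (n + K) w), z⟫_ℂ)
        (hG₂P : ∀ n, ∀ w z : lp (fun _ : (Fin 3 → ℤ) => EuclideanSpace ℂ (Fin 3)) 2,
          ⟪G₂ w, cubeProj (n + K) z⟫_ℂ = ⟪G₂ (cubeProj (n + K) w), z⟫_ℂ)
        (hGP : ∀ n, ∀ w z : lp (fun _ : (Fin 3 → ℤ) => EuclideanSpace ℂ (Fin 3)) 2,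
          ⟪G w, cubeProj (n + K) z⟫_ℂ = ⟪G (cubeProj (n + K) w), z⟫_ℂ)
        (hG₁pos : ∀ x : lp (fun _ : (Fin 3 → ℤ) => EuclideanSpace ℂ (Fin 3)) 2, 0 ≤ re ⟪G₁ x, x⟫_ℂ)
        {ω c m₂ M₁ : ℝ} (hc : 0 < c) (hm₂ : 0 < m₂) (hM₁ : 0 ≤ M₁)
        (hm₂' : ∀ x : lp (fun _ : (Fin 3 → ℤ) => EuclideanSpace ℂ (Fin 3)) 2, m₂ * ‖x‖ ^ 2 ≤ re ⟪G₂ x, x⟫_ℂ)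
        (hM₁' : ∀ x : lp (fun _ : (Fin 3 → ℤ) => EuclideanSpace ℂ (Fin 3)) 2,
          re ⟪G₁ x, x⟫_ℂ ≤ M₁ * (eNormSq (-1) (⇑x)).toReal)
        {m M ω₁ : ℝ} (hm0 : 0 < m)
        (hm : ∀ x : lp (fun _ : (Fin 3 → ℤ) => EuclideanSpace ℂ (Fin 3)) 2, m * ‖x‖ ^ 2 ≤ re ⟪G x, x⟫_ℂ)
        (hM : ∀ x : lp (fun _ : (Fin 3 → ℤ) => EuclideanSpace ℂ (Fin 3)) 2, re ⟪G x, x⟫_ℂ ≤ M * ‖x‖ ^ 2)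
        (h₁ : ∀ n, ∀ w : lp (fun _ : (Fin 3 → ℤ) => EuclideanSpace ℂ (Fin 3)) 2,
          2 * re ⟪G₁ (cubeProj (n + K) w), linOp ν (mFourierCoeff (EuclideanSpace.complexify ∘ Torus.abcFlow A B C))
            (fun j => (EuclideanSpace.proj j : EuclideanSpace ℂ (Fin 3) →L[ℂ] ℂ)) lerayCLM (cubeProj (n + K) w)⟫_ℂ +
            c * re ⟪G₂ (cubeProj (n + K) w), cubeProj (n + K) w⟫_ℂ ≤ 2 * ω * re ⟪G₁ (cubeProj (n + K) w), cubeProj (n + K) w⟫_ℂ)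
        (h₂ : ∀ n, ∀ w : lp (fun _ : (Fin 3 → ℤ) => EuclideanSpace ℂ (Fin 3)) 2,
          re ⟪G₂ (cubeProj (n + K) w), linOp ν (mFourierCoeff (EuclideanSpace.complexify ∘ Torus.abcFlow A B C))
            (fun j => (EuclideanSpace.proj j : EuclideanSpace ℂ (Fin 3) →L[ℂ] ℂ)) lerayCLM (cubeProj (n + K) w)⟫_ℂ ≤
            ω * re ⟪G₂ (cubeProj (n + K) w), cubeProj (n + K) w⟫_ℂ)
        (hL : ∀ n, ∀ w : lp (fun _ : (Fin 3 → ℤ) => EuclideanSpace ℂ (Fin 3)) 2,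
          re ⟪G (cubeProj (n + K) w), linOp ν (mFourierCoeff (EuclideanSpace.complexify ∘ Torus.abcFlow A B C))
            (fun j => (EuclideanSpace.proj j : EuclideanSpace ℂ (Fin 3) →L[ℂ] ℂ)) lerayCLM (cubeProj (n + K) w)⟫_ℂ ≤
            ω₁ * re ⟪G (cubeProj (n + K) w), cubeProj (n + K) w⟫_ℂ)
        (hμ₁ : μt ≤ ω₁) (hμ₂ : μt ≤ ω)
        (htail : ∀ n, ∀ q : lp (fun _ : (Fin 3 → ℤ) => EuclideanSpace ℂ (Fin 3)) 2, cubeProj (n + K) q = 0 →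
          2 * μt * re ⟪G₁ q, q⟫_ℂ + c * re ⟪G₂ q, q⟫_ℂ ≤ 2 * ω * re ⟪G₁ q, q⟫_ℂ)
        (hgap : ω < 2 * μ)
        {C' : ℝ}
        (hCC' : Real.sqrt (M₁ / (c * m₂)) * (2 * ((Fintype.card (Fin 3) : ℝ) * (2 * Real.pi)) *
            Real.sqrt ((∑' l : Fin 3 → ℤ, ENNReal.ofReal (sobolevWeight (-2) l ^ 2)).toReal)) *
            Real.sqrt (Real.pi / (2 * μ - ω)) < C')
        -- target amplitude and perturbation size
        {a : ℝ} (ha : 0 < a) (haC : a < 1 / (9 * C')) {ε : ℝ} (hε : 0 < ε) (hεa : ε ≤ 2 * a),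
        ∃ w : ℝ → lp (fun _ : (Fin 3 → ℤ) => EuclideanSpace ℂ (Fin 3)) 2,
          ContinuousOn w (Icc 0 (Real.log (2 * a / ε) / μ)) ∧ w 0 = ε • v ∧
          (∀ t ∈ Ioo 0 (Real.log (2 * a / ε) / μ), HasDerivAt w (nsField ν (mFourierCoeff (EuclideanSpace.complexify ∘ Torus.abcFlow A B C))
            (fun j => (EuclideanSpace.proj j : EuclideanSpace ℂ (Fin 3) →L[ℂ] ℂ)) lerayCLM (w t)) t) ∧
          (∃ Cw : ℝ, 0 ≤ Cw ∧ ∀ t ∈ Icc 0 (Real.log (2 * a / ε) / μ), ∀ k,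
            ‖(w t : (Fin 3 → ℤ) → EuclideanSpace ℂ (Fin 3)) k‖ ≤ Cw * sobolevWeight (-((Fintype.card (Fin 3) : ℝ) + 3)) k) ∧
          (∀ t ∈ Icc 0 (Real.log (2 * a / ε) / μ), ∀ k, lerayCLM k ((w t : (Fin 3 → ℤ) → EuclideanSpace ℂ (Fin 3)) k) =
            (w t : (Fin 3 → ℤ) → EuclideanSpace ℂ (Fin 3)) k) ∧
          (∀ t ∈ Icc 0 (Real.log (2 * a / ε) / μ), ∀ (j : Fin 3) (k : Fin 3 → ℤ),
            (EuclideanSpace.proj j : EuclideanSpace ℂ (Fin 3) →L[ℂ] ℂ) ((w t : (Fin 3 → ℤ) → EuclideanSpace ℂ (Fin 3)) (-k)) =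
              conj ((EuclideanSpace.proj j : EuclideanSpace ℂ (Fin 3) →L[ℂ] ℂ) ((w t : (Fin 3 → ℤ) → EuclideanSpace ℂ (Fin 3)) k))) ∧
          (∀ t ∈ Icc 0 (Real.log (2 * a / ε) / μ), ∀ k : Fin 3 → ℤ,
            ∑ j, ((k j : ℤ) : ℂ) * (EuclideanSpace.proj j : EuclideanSpace ℂ (Fin 3) →L[ℂ] ℂ)
              ((w t : (Fin 3 → ℤ) → EuclideanSpace ℂ (Fin 3)) k) = 0) ∧
          -- growth along the whole window, and the amplitude `a` at its end
          (∀ t ∈ Icc 0 (Real.log (2 * a / ε) / μ), ε * Real.exp (μ * t) / 2 ≤ ‖w t‖) ∧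
          a ≤ ‖w (Real.log (2 * a / ε) / μ)‖ ∧
          -- uniqueness in the class
          ∀ {w' : ℝ → lp (fun _ : (Fin 3 → ℤ) => EuclideanSpace ℂ (Fin 3)) 2}
            (_hw' : ContinuousOn w' (Icc 0 (Real.log (2 * a / ε) / μ))) (_hw'0 : w' 0 = ε • v)
            (_hw'' : ∀ t ∈ Ioo 0 (Real.log (2 * a / ε) / μ), HasDerivAt w'
              (nsField ν (mFourierCoeff (EuclideanSpace.complexify ∘ Torus.abcFlow A B C))
                (fun j => (EuclideanSpace.proj j : EuclideanSpace ℂ (Fin 3) →L[ℂ] ℂ)) lerayCLM (w' t)) t)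
            {C'w : ℝ} (_hC'w : 0 ≤ C'w)
            (_hw'dec : ∀ t ∈ Icc 0 (Real.log (2 * a / ε) / μ), ∀ k, ‖(w' t : (Fin 3 → ℤ) → EuclideanSpace ℂ (Fin 3)) k‖ ≤
              C'w * sobolevWeight (-((Fintype.card (Fin 3) : ℝ) + 3)) k)
            (_hw'fix : ∀ t ∈ Icc 0 (Real.log (2 * a / ε) / μ), ∀ k,
              lerayCLM k ((w' t : (Fin 3 → ℤ) → EuclideanSpace ℂ (Fin 3)) k) = (w' t : (Fin 3 → ℤ) → EuclideanSpace ℂ (Fin 3)) k)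
            (_hw'real : ∀ t ∈ Icc 0 (Real.log (2 * a / ε) / μ), ∀ (j : Fin 3) (k : Fin 3 → ℤ),
              (EuclideanSpace.proj j : EuclideanSpace ℂ (Fin 3) →L[ℂ] ℂ) ((w' t : (Fin 3 → ℤ) → EuclideanSpace ℂ (Fin 3)) (-k)) =
                conj ((EuclideanSpace.proj j : EuclideanSpace ℂ (Fin 3) →L[ℂ] ℂ) ((w' t : (Fin 3 → ℤ) → EuclideanSpace ℂ (Fin 3)) k)))
            (_hw'div : ∀ t ∈ Icc 0 (Real.log (2 * a / ε) / μ), ∀ k : Fin 3 → ℤ,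
              ∑ j, ((k j : ℤ) : ℂ) * (EuclideanSpace.proj j : EuclideanSpace ℂ (Fin 3) →L[ℂ] ℂ)
                ((w' t : (Fin 3 → ℤ) → EuclideanSpace ℂ (Fin 3)) k) = 0),
            EqOn w' w (Icc 0 (Real.log (2 * a / ε) / μ)) := by
  obtain ⟨v, hv1, hvr, hvP, hvreal, hvdiv, hAv, H⟩ := exists_keep_solution_abc_final K A B C hν hμ.le heig
  refine ⟨v, hv1, hvr, hvP, hvreal, hvdiv, hAv, ?_⟩
  intro μt G₁ G₂ G hG₁ hG₂ hG hG₁P hG₂P hGP hG₁pos ω c m₂ M₁ hc hm₂ hM₁ hm₂' hM₁' m M ω₁ hm0 hm hM h₁ h₂ hL hμ₁ hμ₂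
    htail hgap C' hCC' a ha haC ε hε hεa
  -- the window arithmetic
  obtain ⟨hT, hexpT, hle⟩ := window_arith hμ hε ha hεa
  have hC'0 : 0 < C' := lt_of_le_of_lt (by positivity) hCC'
  have h9 : 9 * C' * a < 1 := by
    have := (lt_div_iff₀ (by positivity : (0 : ℝ) < 9 * C')).1 haC
    linarith
  have hsmall : ∀ t ∈ Icc 0 (Real.log (2 * a / ε) / μ), C' * (3 / 2 : ℝ) ^ 2 * (ε * Real.exp (μ * t)) < 3 / 2 - 1 := by
    intro t ht
    have h := hle t ht
    have hC'94 : 0 ≤ C' * (3 / 2 : ℝ) ^ 2 := by positivity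
    calc C' * (3 / 2 : ℝ) ^ 2 * (ε * Real.exp (μ * t)) ≤ C' * (3 / 2 : ℝ) ^ 2 * (2 * a) :=
          mul_le_mul_of_nonneg_left h hC'94
      _ = (9 * C' * a) / 2 := by ring
      _ < 3 / 2 - 1 := by linarith
  have hχ : ∀ t ∈ Icc 0 (Real.log (2 * a / ε) / μ), ε * Real.exp (μ * t) ≤ 2 / (9 * C') := by
    intro t ht
    refine (hle t ht).trans ?_
    rw [le_div_iff₀ (by positivity : (0 : ℝ) < 9 * C')]
    linarith
  -- THE solution on the explicit window
  obtain ⟨w, hw, hw0, hw', htailw, hwfix, hwreal, hwdiv, hfloor, huniq⟩ := H hT hε hG₁ hG₂ hG hG₁P hG₂P hGP hG₁pos hc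
    hm₂ hM₁ hm₂' hM₁' hm0 hm hM h₁ h₂ hL hμ₁ hμ₂ htail hgap hCC' hsmall
  refine ⟨w, hw, hw0, hw', htailw, hwfix, hwreal, hwdiv, fun t ht => hfloor t ht (hχ t ht), ?_,
    fun hw'c hw'0 hw'' _ hC'w hw'dec hw'fix hw'real hw'div => huniq hw'c hw'0 hw'' hC'w hw'dec hw'fix hw'real hw'div⟩
  -- the amplitude at the end of the window: `ε e^{μT}/2 = a`
  have hend := hfloor (Real.log (2 * a / ε) / μ) ⟨hT, le_rfl⟩ (hχ _ ⟨hT, le_rfl⟩)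
  rw [hexpT] at hend
  linarith

end Summit.NavierStokesRegularity.FluidComputer.TransportGalerkinAbcAmplitude

end
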